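import Literature.NumberTheory.LFunctions.SuzukiScrewLineThm42RProofs
import Literature.NumberTheory.LFunctions.UniformWeilPositivityRH
import Summits.RiemannHypothesis.RiemannHypothesis.Theorems.ZetaStringKernelWeilDictionary
import Summits.RiemannHypothesis.RiemannHypothesis.Theorems.IntegerScrewNestedSylvester
import HarnessLib

/-!
# The CHRISTOFFEL LAW of the screw Gram chain: `λ_M(γ₀) ≥ m(ρ₀)` for every `M` is Weil/RH re-indexed (EM-3; column DBR)

LINE 1 — LABEL: §1 and the linear-algebra lemma of §4 are RH-FREE; §2/§4 are RH-CONSEQUENCES (the binder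
`RiemannHypothesis →` is never dropped); the `∀`-configuration statements of §3/§4 are RH-EQUIVALENT — labelled, proved
as equivalences, NOT claimed. bears_on: LADDER-RH B-D → B-P (cell rh-dbr, D-0074 D3 seat rh-dbr-eng-5 «E_M from H_M»:
D-0040 rung 3 «prove the results of the data» for this seat's table EM-1/EM-2 = HOME/DATA.md §EM-1 Q-scores, §EM-2 Q7:
«λ_M(γ_k) > 1 certified for all k ≤ 22, M ≤ 512; λ_128(γ_1) − 1 = 0.01255»; LADDER §5.6 tautology test «is this law
Weil/RH re-indexed?» — answered YES here, in the kernel, with the exact constant). WHAT THIS IS NOT: progress toward RH;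
`λ_M(γ_k) > 1` at any finite `M` certifies nothing about `ζ`; the theorems say that the Christoffel instrument of the
Gram chain reads Suzuki's explicit formula (1.9), nothing more.

## The objects (all in the tree; no definitions here)
Suzuki's kernel `G(t,u) = Ψ(t) + Ψ(u) − Ψ(t−u)` (`zetaScrewKernel`), its Gram matrices on the integer nodes
`S_M = [G(log m, log m′)]_{2 ≤ m,m′ ≤ M} = IntegerScrew.screwMatrix (M−1)`, and — EM-1's instrument — the CHRISTOFFEL
FUNCTION of the chain at a real frequency `γ`: `λ_M(γ) := γ² / K_M(γ,γ)`, `K_M(γ,γ) := v(γ)* S_M⁻¹ v(γ) = cᵀS_M⁻¹c + sᵀS_M⁻¹s`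
with `v_m(γ) = m^{iγ} − 1`, `c_m = cos(γ log m) − 1`, `s_m = sin(γ log m)` (the reproducing kernel on the diagonal of
`span{m^{iγ} − 1 : m ≤ M}`; EM-1 wrote it as `Σ_{m ≤ M} |E_m(γ)|²/d_m` through the innovation functions `E_m` and the
pivots `d_m = screwPivot m`).

## Results
* §1 (RH-FREE algebra of ONE zero) `Σ_{ij} x_i x_j (e^{−iγt_i} − 1)(e^{iγt_j} − 1) = |Σ_j x_j (e^{iγt_j} − 1)|²
  = (Σ_j x_j (cos γt_j − 1))² + (Σ_j x_j sin γt_j)²` (`sum_sum_mul_cexp_eq_norm_sq`, `norm_sq_sum_cexp_eq`).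
* §2 (RH ⟹) from the tree's UNCONDITIONAL zero series `G(t,u) = Σ_ρ m_ρ (e^{−iγ_ρt} − 1)(e^{iγ_ρu} − 1)/γ_ρ²`
  (`ScrewLineThm42.hasSum_zetaScrewKernel`, Suzuki 2023 (1.9)): under RH every term of the quadratic form is
  `m_ρ |Σ_j x_j(e^{iγ_ρt_j} − 1)|²/γ_ρ² ≥ 0`, so dropping all but `ρ₀, ρ̄₀` gives, for EVERY non-trivial zero
  `ρ₀ = ½ + iγ₀` and every finite real configuration,
  **`(2 m(ρ₀)/γ₀²) · |Σ_j x_j (e^{iγ₀t_j} − 1)|² ≤ Σ_{ij} G(t_i,t_j) x_i x_j`** (`oneZero_bound_of_riemannHypothesis`).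
* §3 the `∀`-configuration form of that bound, for ONE zero, is EQUIVALENT to RH (`riemannHypothesis_iff_oneZero_bound`;
  ⟸ because the bound is `≥ 0`: Weil's criterion in the Kreĭn coordinate, `weilPositivityOn_iff_sum_sum_zetaScrewKernel_nonneg`
  + `riemannHypothesis_iff_forall_weilPositivityOn`). RH-EQUIVALENT, labelled, not claimed.
* §4 at the integer nodes: **RH ⟹ `S_M − (2m₀/γ₀²)(c cᵀ + s sᵀ) ⪰ 0` for every `M`** (inverse-free form,
  `screwMatrix_oneZero_bound_of_riemannHypothesis`); the RH-FREE lemma «`S ≻ 0`, `α (y·v)² ≤ yᵀSy ∀y` ⟹ `vᵀS⁻¹v ≤ 1/α`»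
  (test on `y = S⁻¹v`; the Christoffel inequality for a Gram matrix); hence **RH ⟹ `K_M(γ₀,γ₀) = cᵀS_M⁻¹c + sᵀS_M⁻¹s ≤ γ₀²/m(ρ₀)`,
  i.e. `λ_M(γ₀) ≥ m(ρ₀) ≥ 1`, for every `M ≥ 2` with `S_M ≻ 0` and every zero** (`christoffel_le_of_riemannHypothesis`,
  `christoffel_le_sq_im_of_riemannHypothesis`) — EM-1's certified law with its constant. The invertibility hypothesis
  `S_M ≻ 0` is itself an RH-consequence (route IntegerScrew's `IntegerScrewPivotCriterion.screwMatrix_posDef_of_riemannHypothesis`)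
  and a kernel theorem for `M ≤ 128` (`IntegerScrewRung128.screwMatrix_posDef_of_le_127`); it is kept as a hypothesis only so that this file stays
  out of that route's import cone. With the same route's `riemannHypothesis_iff_screwMatrix_posSemidef` the integer-node
  `∀ M` form of the bound is again RH-EQUIVALENT (not imported here; labelled, not claimed).

References: M. Suzuki, J. Lond. Math. Soc. (2) 108 (2023) = arXiv:2206.03682, (1.4), (1.9), Thm 1.2; M. Suzuki, Canad. J.
Math. 2025 = arXiv:2301.00421v3, (4.9); P. Nevai, G. Freud, «Orthogonal polynomials and Christoffel functions» (1986) §4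
(the Christoffel inequality `λ_n(μ; x) ≥ μ({x})`), of which §4 is the finite Gram-matrix instance.
-/

-- `Summit.RiemannHypothesis.RiemannHypothesis.…` duplicates `RiemannHypothesis` BY DESIGN (D-0017).
set_option linter.dupNamespace false

noncomputable section

open Complex Finset Matrix
open scoped BigOperators ComplexConjugate

namespace Summit.RiemannHypothesis.RiemannHypothesis.Theorems.ScrewChristoffel

open Literature.NumberTheory.LFunctions Literature.NumberTheory.LFunctions.ZetaZeros
open Summit.RiemannHypothesis.RiemannHypothesis.Theorems.IntegerScrew
open Summit.RiemannHypothesis.RiemannHypothesis.Theorems.ZetaStringArchWall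
  (weilPositivityOn_iff_sum_sum_zetaScrewKernel_nonneg)

variable {N : ℕ}

/-! ## §1 RH-FREE algebra of one zero's kernel -/

/-- For real weights, `x_j(e^{−iγt_j} − 1)` is the conjugate of `x_j(e^{iγt_j} − 1)`. [folklore] -/
theorem conj_mul_cexp_sub_one (γ t x : ℝ) :
    conj ((x : ℂ) * (cexp (I * γ * t) - 1)) = (x : ℂ) * (cexp (-(I * γ * t)) - 1) := by
  rw [map_mul, Complex.conj_ofReal, map_sub, map_one, ← Complex.exp_conj, map_mul, map_mul, Complex.conj_I,
    Complex.conj_ofReal, Complex.conj_ofReal]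
  congr 3
  ring

/-- **One zero's kernel is a rank-one hermitian square**: for real `γ, t_j, x_j`,
`Σ_i Σ_j x_i x_j (e^{−iγt_i} − 1)(e^{iγt_j} − 1) = |Σ_j x_j (e^{iγt_j} − 1)|²`. RH-FREE. [folklore] -/
theorem sum_sum_mul_cexp_eq_norm_sq (γ : ℝ) (t x : Fin N → ℝ) :
    ∑ i, ∑ j, (x i : ℂ) * (x j : ℂ) * ((cexp (-(I * γ * (t i : ℝ))) - 1) * (cexp (I * γ * (t j : ℝ)) - 1)) =
      (((‖∑ j, (x j : ℂ) * (cexp (I * γ * (t j : ℝ)) - 1)‖ ^ 2 : ℝ)) : ℂ) := by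
  set z : Fin N → ℂ := fun j => (x j : ℂ) * (cexp (I * γ * (t j : ℝ)) - 1) with hz
  have hconj : ∀ j, conj (z j) = (x j : ℂ) * (cexp (-(I * γ * (t j : ℝ))) - 1) := fun j =>
    conj_mul_cexp_sub_one γ (t j) (x j)
  calc ∑ i, ∑ j, (x i : ℂ) * (x j : ℂ) * ((cexp (-(I * γ * (t i : ℝ))) - 1) * (cexp (I * γ * (t j : ℝ)) - 1))
      = ∑ i, ∑ j, conj (z i) * z j := by
        refine sum_congr rfl fun i _ => sum_congr rfl fun j _ => ?_
        rw [hconj]; simp only [hz]; ring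
    _ = conj (∑ i, z i) * ∑ j, z j := by rw [map_sum, sum_mul_sum]
    _ = (((‖∑ j, z j‖ ^ 2 : ℝ)) : ℂ) := by rw [Complex.conj_mul']; push_cast; rfl

/-- `|Σ_j x_j (e^{iγt_j} − 1)|² = (Σ_j x_j (cos γt_j − 1))² + (Σ_j x_j sin γt_j)²`. RH-FREE. [folklore] -/
theorem norm_sq_sum_cexp_eq (γ : ℝ) (t x : Fin N → ℝ) :
    ‖∑ j, (x j : ℂ) * (cexp (I * γ * (t j : ℝ)) - 1)‖ ^ 2 =
      (∑ j, x j * (Real.cos (γ * t j) - 1)) ^ 2 + (∑ j, x j * Real.sin (γ * t j)) ^ 2 := by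
  rw [Complex.sq_norm, Complex.normSq_apply, Complex.re_sum, Complex.im_sum]
  have hre : ∀ j, ((x j : ℂ) * (cexp (I * γ * (t j : ℝ)) - 1)).re = x j * (Real.cos (γ * t j) - 1) := by
    intro j
    have e : I * (γ : ℂ) * ((t j : ℝ) : ℂ) = ((γ * t j : ℝ) : ℂ) * I := by push_cast; ring
    rw [e, Complex.re_ofReal_mul, Complex.sub_re, Complex.exp_ofReal_mul_I_re, Complex.one_re]
  have him : ∀ j, ((x j : ℂ) * (cexp (I * γ * (t j : ℝ)) - 1)).im = x j * Real.sin (γ * t j) := by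
    intro j
    have e : I * (γ : ℂ) * ((t j : ℝ) : ℂ) = ((γ * t j : ℝ) : ℂ) * I := by push_cast; ring
    rw [e, Complex.im_ofReal_mul, Complex.sub_im, Complex.exp_ofReal_mul_I_im, Complex.one_im, sub_zero]
  simp only [hre, him]
  ring

/-- Changing `γ ↦ −γ` conjugates the sum, so its norm is unchanged. RH-FREE. [folklore] -/
theorem norm_sum_cexp_neg (γ : ℝ) (t x : Fin N → ℝ) :
    ‖∑ j, (x j : ℂ) * (cexp (I * ((-γ : ℝ) : ℂ) * (t j : ℝ)) - 1)‖ =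
      ‖∑ j, (x j : ℂ) * (cexp (I * γ * (t j : ℝ)) - 1)‖ := by
  rw [← Complex.norm_conj (∑ j, (x j : ℂ) * (cexp (I * γ * (t j : ℝ)) - 1)), map_sum]
  congr 1
  refine sum_congr rfl fun j _ => ?_
  rw [conj_mul_cexp_sub_one]
  congr 3
  push_cast; ring

/-! ## §2 Under RH: the quadratic form of `G` dominates each zero's rank-two kernel -/

/-- Under RH, `γ_ρ = i(ρ − ½) = −Im ρ` is real. RH-CONSEQUENCE. [cite: Suzuki2023, Thm 1.2 (RH side)] -/
theorem suzukiZeroParam_eq_of_riemannHypothesis (hRH : _root_.RiemannHypothesis)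
    (ρ : riemannZetaNontrivialZeros) : suzukiZeroParam (ρ : ℂ) = ((-(ρ : ℂ).im : ℝ) : ℂ) := by
  have him := suzukiZeroParam_im_eq_zero hRH ρ.2
  have hre : (ρ : ℂ).re = 1 / 2 := by
    have : (suzukiZeroParam (ρ : ℂ)).im = (ρ : ℂ).re - 1 / 2 := by simp [suzukiZeroParam]
    linarith
  apply Complex.ext
  · simp [suzukiZeroParam]
  · simp [suzukiZeroParam, hre]

/-- The `ρ`-th term of the quadratic form `Σ_{ij} x_i x_j G(t_i,t_j)`, under RH, is the non-negative real
`m_ρ |Σ_j x_j(e^{−i Im(ρ) t_j} − 1)|² / (Im ρ)²`. RH-CONSEQUENCE. [cite: Suzuki2025WeilHilbertSpace, eq. (4.9)] -/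
theorem quadTerm_eq_of_riemannHypothesis (hRH : _root_.RiemannHypothesis) (ρ : riemannZetaNontrivialZeros)
    (t x : Fin N → ℝ) :
    ∑ i, ∑ j, ((x i * x j : ℝ) : ℂ) * ((riemannZetaZeroOrder (ρ : ℂ) : ℂ) *
      (((cexp (-(I * suzukiZeroParam (ρ : ℂ) * (t i : ℝ))) - 1) * (cexp (I * suzukiZeroParam (ρ : ℂ) * (t j : ℝ)) - 1) /
        suzukiZeroParam (ρ : ℂ) ^ 2))) =
      (((riemannZetaZeroOrder (ρ : ℂ) : ℝ) / (ρ : ℂ).im ^ 2 *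
        ‖∑ j, (x j : ℂ) * (cexp (I * ((-(ρ : ℂ).im : ℝ) : ℂ) * (t j : ℝ)) - 1)‖ ^ 2 : ℝ) : ℂ) := by
  rw [suzukiZeroParam_eq_of_riemannHypothesis hRH ρ]
  have hsq : (((-(ρ : ℂ).im : ℝ) : ℂ)) ^ 2 = (((ρ : ℂ).im ^ 2 : ℝ) : ℂ) := by push_cast; ring
  have h1 : ∑ i, ∑ j, ((x i * x j : ℝ) : ℂ) * ((riemannZetaZeroOrder (ρ : ℂ) : ℂ) *
      (((cexp (-(I * ((-(ρ : ℂ).im : ℝ) : ℂ) * (t i : ℝ))) - 1) *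
        (cexp (I * ((-(ρ : ℂ).im : ℝ) : ℂ) * (t j : ℝ)) - 1) / (((-(ρ : ℂ).im : ℝ) : ℂ)) ^ 2))) =
      (riemannZetaZeroOrder (ρ : ℂ) : ℂ) / (((-(ρ : ℂ).im : ℝ) : ℂ)) ^ 2 *
        ∑ i, ∑ j, (x i : ℂ) * (x j : ℂ) * (((cexp (-(I * ((-(ρ : ℂ).im : ℝ) : ℂ) * (t i : ℝ))) - 1) *
          (cexp (I * ((-(ρ : ℂ).im : ℝ) : ℂ) * (t j : ℝ)) - 1))) := by
    rw [mul_sum]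
    refine sum_congr rfl fun i _ => ?_
    rw [mul_sum]
    refine sum_congr rfl fun j _ => ?_
    push_cast
    ring
  rw [h1, sum_sum_mul_cexp_eq_norm_sq, hsq]
  push_cast
  ring

/-- The quadratic form of `G` as a series over the zeros (RH-FREE; finite linear combination of
`ScrewLineThm42.hasSum_zetaScrewKernel`). [cite: Suzuki2025WeilHilbertSpace, eq. (4.9); Suzuki2023, eq. (1.9)] -/
theorem hasSum_quadForm (t x : Fin N → ℝ) :
    HasSum (fun ρ : riemannZetaNontrivialZeros => ∑ i, ∑ j, ((x i * x j : ℝ) : ℂ) *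
      ((riemannZetaZeroOrder (ρ : ℂ) : ℂ) *
        (((cexp (-(I * suzukiZeroParam (ρ : ℂ) * (t i : ℝ))) - 1) * (cexp (I * suzukiZeroParam (ρ : ℂ) * (t j : ℝ)) - 1) /
          suzukiZeroParam (ρ : ℂ) ^ 2))))
      (((∑ i, ∑ j, zetaScrewKernel (t i) (t j) * (x i * x j) : ℝ)) : ℂ) := by
  have e : (((∑ i, ∑ j, zetaScrewKernel (t i) (t j) * (x i * x j) : ℝ)) : ℂ) =
      ∑ i, ∑ j, ((x i * x j : ℝ) : ℂ) * (zetaScrewKernel (t i) (t j) : ℂ) := by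
    push_cast
    exact sum_congr rfl fun i _ => sum_congr rfl fun j _ => by ring
  rw [e]
  exact hasSum_sum fun i _ => hasSum_sum fun j _ =>
    (ScrewLineThm42.hasSum_zetaScrewKernel (t i) (t j)).mul_left _

/-- **RH ⟹ the one-zero lower bound.** Under RH, for every non-trivial zero `ρ₀ = ½ + iγ₀` (multiplicity `m(ρ₀)`)
and every finite real configuration `(t_j, x_j)`:
`(2 m(ρ₀)/γ₀²) · |Σ_j x_j (e^{iγ₀ t_j} − 1)|² ≤ Σ_{ij} G(t_i,t_j) x_i x_j`
(drop every term of the zero series except `ρ₀` and `ρ̄₀ = 1 − ρ₀`, which contribute equally). RH-CONSEQUENCE — the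
binder is never dropped. [cite: Suzuki2023, (1.9) and Thm 1.2] -/
theorem oneZero_bound_of_riemannHypothesis (hRH : _root_.RiemannHypothesis) (ρ₀ : riemannZetaNontrivialZeros)
    (t x : Fin N → ℝ) :
    2 * (riemannZetaZeroOrder (ρ₀ : ℂ) : ℝ) / (ρ₀ : ℂ).im ^ 2 *
        ‖∑ j, (x j : ℂ) * (cexp (I * ((ρ₀ : ℂ).im : ℂ) * (t j : ℝ)) - 1)‖ ^ 2 ≤
      ∑ i, ∑ j, zetaScrewKernel (t i) (t j) * (x i * x j) := by
  -- the real, non-negative terms of the series under RH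
  set r : riemannZetaNontrivialZeros → ℝ := fun ρ => (riemannZetaZeroOrder (ρ : ℂ) : ℝ) / (ρ : ℂ).im ^ 2 *
    ‖∑ j, (x j : ℂ) * (cexp (I * ((-(ρ : ℂ).im : ℝ) : ℂ) * (t j : ℝ)) - 1)‖ ^ 2 with hr
  have hsum : HasSum r (∑ i, ∑ j, zetaScrewKernel (t i) (t j) * (x i * x j)) := by
    have h := hasSum_quadForm t x
    simp only [quadTerm_eq_of_riemannHypothesis hRH] at h
    exact Complex.hasSum_ofReal.1 h
  have hr0 : ∀ ρ, 0 ≤ r ρ := fun ρ => by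
    have hm0 : (0 : ℝ) ≤ riemannZetaZeroOrder (ρ : ℂ) := ZetaZeroSum.zeroOrder_nonneg ρ
    positivity
  -- the conjugate zero
  set ρ₁ : riemannZetaNontrivialZeros := ⟨conj (ρ₀ : ℂ), riemannZetaNontrivialZeros.conj_mem ρ₀.2⟩ with hρ₁
  have hne : ρ₀ ≠ ρ₁ := by
    intro h
    have him : (ρ₀ : ℂ).im = (conj (ρ₀ : ℂ)).im := by
      have := congrArg (fun ρ : riemannZetaNontrivialZeros => (ρ : ℂ).im) h
      simpa [hρ₁] using this
    rw [Complex.conj_im] at him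
    exact riemannZetaNontrivialZeros.im_ne_zero ρ₀.2 (by linarith)
  have hr1 : r ρ₁ = r ρ₀ := by
    simp only [hr, hρ₁, Complex.conj_im, neg_neg]
    rw [riemannZetaZeroOrder_conj_holds, norm_sum_cexp_neg, neg_sq]
  have h2 := sum_le_hasSum ({ρ₀, ρ₁} : Finset riemannZetaNontrivialZeros) (fun ρ _ => hr0 ρ) hsum
  rw [sum_pair hne, hr1, ← two_mul] at h2
  have e : r ρ₀ = (riemannZetaZeroOrder (ρ₀ : ℂ) : ℝ) / (ρ₀ : ℂ).im ^ 2 *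
      ‖∑ j, (x j : ℂ) * (cexp (I * ((ρ₀ : ℂ).im : ℂ) * (t j : ℝ)) - 1)‖ ^ 2 := by
    simp only [hr]
    rw [norm_sum_cexp_neg]
  rw [e] at h2
  calc 2 * (riemannZetaZeroOrder (ρ₀ : ℂ) : ℝ) / (ρ₀ : ℂ).im ^ 2 *
        ‖∑ j, (x j : ℂ) * (cexp (I * ((ρ₀ : ℂ).im : ℂ) * (t j : ℝ)) - 1)‖ ^ 2
      = 2 * ((riemannZetaZeroOrder (ρ₀ : ℂ) : ℝ) / (ρ₀ : ℂ).im ^ 2 *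
        ‖∑ j, (x j : ℂ) * (cexp (I * ((ρ₀ : ℂ).im : ℂ) * (t j : ℝ)) - 1)‖ ^ 2) := by ring
    _ ≤ _ := h2

/-- The same bound in real form: `(2m₀/γ₀²)[(Σ_j x_j(cos γ₀t_j − 1))² + (Σ_j x_j sin γ₀t_j)²] ≤ Σ_{ij} G(t_i,t_j) x_i x_j`.
RH-CONSEQUENCE. [cite: Suzuki2023, (1.9) and Thm 1.2] -/
theorem oneZero_bound_real_of_riemannHypothesis (hRH : _root_.RiemannHypothesis) (ρ₀ : riemannZetaNontrivialZeros)
    (t x : Fin N → ℝ) :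
    2 * (riemannZetaZeroOrder (ρ₀ : ℂ) : ℝ) / (ρ₀ : ℂ).im ^ 2 *
        ((∑ j, x j * (Real.cos ((ρ₀ : ℂ).im * t j) - 1)) ^ 2 + (∑ j, x j * Real.sin ((ρ₀ : ℂ).im * t j)) ^ 2) ≤
      ∑ i, ∑ j, zetaScrewKernel (t i) (t j) * (x i * x j) := by
  rw [← norm_sq_sum_cexp_eq]
  exact oneZero_bound_of_riemannHypothesis hRH ρ₀ t x

/-! ## §3 The `∀`-configuration form for ONE zero is RH (RH-EQUIVALENT; labelled, not claimed) -/

/-- RH-EQUIVALENT (labelled; NOT claimed): for any fixed non-trivial zero `ρ₀`, RH holds iff Suzuki's kernel dominates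
`ρ₀`'s rank-two kernel on EVERY finite real configuration. (⟹ §2; ⟸ the bound is `≥ 0`, so `G ⪰ 0` on every window,
which is Weil's criterion in the Kreĭn coordinate.) [cite: Suzuki2023, Thm 1.2] -/
theorem riemannHypothesis_iff_oneZero_bound (ρ₀ : riemannZetaNontrivialZeros) :
    _root_.RiemannHypothesis ↔ ∀ (N : ℕ) (t x : Fin N → ℝ),
      2 * (riemannZetaZeroOrder (ρ₀ : ℂ) : ℝ) / (ρ₀ : ℂ).im ^ 2 *
          ‖∑ j, (x j : ℂ) * (cexp (I * ((ρ₀ : ℂ).im : ℂ) * (t j : ℝ)) - 1)‖ ^ 2 ≤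
        ∑ i, ∑ j, zetaScrewKernel (t i) (t j) * (x i * x j) := by
  refine ⟨fun hRH N t x => oneZero_bound_of_riemannHypothesis hRH ρ₀ t x, fun h => ?_⟩
  refine riemannHypothesis_iff_forall_weilPositivityOn.2 fun a _ => ?_
  refine (weilPositivityOn_iff_sum_sum_zetaScrewKernel_nonneg a).2 fun N t x _ => ?_
  have hm0 : (0 : ℝ) ≤ riemannZetaZeroOrder (ρ₀ : ℂ) := ZetaZeroSum.zeroOrder_nonneg ρ₀
  exact le_trans (by positivity) (h N t x)

/-! ## §4 The integer nodes: EM-1's Christoffel law `λ_M(γ₀) ≥ m(ρ₀)` -/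

/-- **RH-FREE linear algebra (the Christoffel inequality for a Gram matrix)**: if `S ≻ 0` and `α (y·v)² ≤ yᵀ S y`
for all `y` (i.e. `S − α v vᵀ ⪰ 0`) with `α > 0`, then `vᵀ S⁻¹ v ≤ 1/α` (test on `y = S⁻¹ v`). [folklore] -/
theorem dotProduct_inv_mulVec_le {n : Type*} [Fintype n] [DecidableEq n] {S : Matrix n n ℝ} (hS : S.PosDef)
    {α : ℝ} (hα : 0 < α) (v : n → ℝ) (h : ∀ y : n → ℝ, α * (y ⬝ᵥ v) ^ 2 ≤ y ⬝ᵥ (S *ᵥ y)) :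
    v ⬝ᵥ (S⁻¹ *ᵥ v) ≤ 1 / α := by
  set u : n → ℝ := S⁻¹ *ᵥ v with hu
  have hSu : S *ᵥ u = v := by
    rw [hu, mulVec_mulVec, mul_nonsing_inv S ((Matrix.isUnit_iff_isUnit_det S).1 hS.isUnit), one_mulVec]
  have hA : u ⬝ᵥ (S *ᵥ u) = v ⬝ᵥ u := by rw [hSu, dotProduct_comm]
  have huv : u ⬝ᵥ v = v ⬝ᵥ u := dotProduct_comm _ _
  have key := h u
  rw [hA, huv] at key
  -- `α A² ≤ A` with `A = v ⬝ᵥ u`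
  set A := v ⬝ᵥ u with hAdef
  by_cases hApos : 0 < A
  · rw [le_div_iff₀ hα, mul_comm]
    nlinarith
  · exact le_trans (not_lt.1 hApos) (by positivity)

variable (n : ℕ)

/-- The quadratic form of `S_{n+1}` on the integer nodes as the kernel double sum with `t_i = log(i+2)`. [folklore] -/
theorem dotProduct_screwMatrix_mulVec (y : Fin n → ℝ) :
    y ⬝ᵥ (screwMatrix n *ᵥ y) =
      ∑ i : Fin n, ∑ j : Fin n, zetaScrewKernel (Real.log (((i : ℕ) + 2 : ℕ) : ℝ))
        (Real.log (((j : ℕ) + 2 : ℕ) : ℝ)) * (y i * y j) := by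
  rw [← screwMatrix_form n y, star_trivial]

/-- **RH ⟹ `S_M − (2m₀/γ₀²)(c cᵀ + s sᵀ) ⪰ 0`** on the integer nodes `log 2, …, log M` (`M = n + 1`), with
`c_i = cos(γ₀ log(i+2)) − 1`, `s_i = sin(γ₀ log(i+2))`, `γ₀ = Im ρ₀`. RH-CONSEQUENCE. [cite: Suzuki2023, (1.9) and Thm 1.2] -/
theorem screwMatrix_oneZero_bound_of_riemannHypothesis (hRH : _root_.RiemannHypothesis)
    (ρ₀ : riemannZetaNontrivialZeros) (y : Fin n → ℝ) :
    2 * (riemannZetaZeroOrder (ρ₀ : ℂ) : ℝ) / (ρ₀ : ℂ).im ^ 2 *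
        ((∑ i : Fin n, y i * (Real.cos ((ρ₀ : ℂ).im * Real.log (((i : ℕ) + 2 : ℕ) : ℝ)) - 1)) ^ 2 +
          (∑ i : Fin n, y i * Real.sin ((ρ₀ : ℂ).im * Real.log (((i : ℕ) + 2 : ℕ) : ℝ))) ^ 2) ≤
      y ⬝ᵥ (screwMatrix n *ᵥ y) := by
  rw [dotProduct_screwMatrix_mulVec]
  exact oneZero_bound_real_of_riemannHypothesis hRH ρ₀ (fun i => Real.log (((i : ℕ) + 2 : ℕ) : ℝ)) y

/-- **THE CHRISTOFFEL LAW (EM-1) UNDER RH, cosine part**: `cᵀ S_M⁻¹ c ≤ γ₀²/(2 m(ρ₀))` (for `S_M ≻ 0`, itself an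
RH-consequence / a kernel theorem for `M ≤ 128`). RH-CONSEQUENCE.
[cite: Suzuki2023, (1.9) and Thm 1.2] -/
theorem cos_dotProduct_inv_le_of_riemannHypothesis (hRH : _root_.RiemannHypothesis) (hS : (screwMatrix n).PosDef)
    (ρ₀ : riemannZetaNontrivialZeros) :
    (fun i : Fin n => Real.cos ((ρ₀ : ℂ).im * Real.log (((i : ℕ) + 2 : ℕ) : ℝ)) - 1) ⬝ᵥ
        ((screwMatrix n)⁻¹ *ᵥ fun i : Fin n => Real.cos ((ρ₀ : ℂ).im * Real.log (((i : ℕ) + 2 : ℕ) : ℝ)) - 1) ≤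
      (ρ₀ : ℂ).im ^ 2 / (2 * (riemannZetaZeroOrder (ρ₀ : ℂ) : ℝ)) := by
  have hm : (1 : ℝ) ≤ riemannZetaZeroOrder (ρ₀ : ℂ) := by
    exact_mod_cast riemannZetaNontrivialZeros.one_le_order ρ₀.2
  have hγ : (ρ₀ : ℂ).im ≠ 0 := riemannZetaNontrivialZeros.im_ne_zero ρ₀.2
  have hm0 : (0 : ℝ) < riemannZetaZeroOrder (ρ₀ : ℂ) := by linarith
  have hα : 0 < 2 * (riemannZetaZeroOrder (ρ₀ : ℂ) : ℝ) / (ρ₀ : ℂ).im ^ 2 := by positivity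
  have h := dotProduct_inv_mulVec_le hS hα
    (fun i : Fin n => Real.cos ((ρ₀ : ℂ).im * Real.log (((i : ℕ) + 2 : ℕ) : ℝ)) - 1) fun y => ?_
  · rw [one_div, inv_div] at h
    exact h
  · refine le_trans ?_ (screwMatrix_oneZero_bound_of_riemannHypothesis n hRH ρ₀ y)
    have e : y ⬝ᵥ (fun i : Fin n => Real.cos ((ρ₀ : ℂ).im * Real.log (((i : ℕ) + 2 : ℕ) : ℝ)) - 1) =
        ∑ i : Fin n, y i * (Real.cos ((ρ₀ : ℂ).im * Real.log (((i : ℕ) + 2 : ℕ) : ℝ)) - 1) := rfl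
    rw [e]
    nlinarith [sq_nonneg (∑ i : Fin n, y i * Real.sin ((ρ₀ : ℂ).im * Real.log (((i : ℕ) + 2 : ℕ) : ℝ))),
      hα.le]

/-- **THE CHRISTOFFEL LAW (EM-1) UNDER RH, sine part**: `sᵀ S_M⁻¹ s ≤ γ₀²/(2 m(ρ₀))` (for `S_M ≻ 0`). RH-CONSEQUENCE.
[cite: Suzuki2023, (1.9) and Thm 1.2] -/
theorem sin_dotProduct_inv_le_of_riemannHypothesis (hRH : _root_.RiemannHypothesis) (hS : (screwMatrix n).PosDef)
    (ρ₀ : riemannZetaNontrivialZeros) :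
    (fun i : Fin n => Real.sin ((ρ₀ : ℂ).im * Real.log (((i : ℕ) + 2 : ℕ) : ℝ))) ⬝ᵥ
        ((screwMatrix n)⁻¹ *ᵥ fun i : Fin n => Real.sin ((ρ₀ : ℂ).im * Real.log (((i : ℕ) + 2 : ℕ) : ℝ))) ≤
      (ρ₀ : ℂ).im ^ 2 / (2 * (riemannZetaZeroOrder (ρ₀ : ℂ) : ℝ)) := by
  have hm : (1 : ℝ) ≤ riemannZetaZeroOrder (ρ₀ : ℂ) := by
    exact_mod_cast riemannZetaNontrivialZeros.one_le_order ρ₀.2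
  have hγ : (ρ₀ : ℂ).im ≠ 0 := riemannZetaNontrivialZeros.im_ne_zero ρ₀.2
  have hm0 : (0 : ℝ) < riemannZetaZeroOrder (ρ₀ : ℂ) := by linarith
  have hα : 0 < 2 * (riemannZetaZeroOrder (ρ₀ : ℂ) : ℝ) / (ρ₀ : ℂ).im ^ 2 := by positivity
  have h := dotProduct_inv_mulVec_le hS hα
    (fun i : Fin n => Real.sin ((ρ₀ : ℂ).im * Real.log (((i : ℕ) + 2 : ℕ) : ℝ))) fun y => ?_
  · rw [one_div, inv_div] at h
    exact h
  · refine le_trans ?_ (screwMatrix_oneZero_bound_of_riemannHypothesis n hRH ρ₀ y)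
    have e : y ⬝ᵥ (fun i : Fin n => Real.sin ((ρ₀ : ℂ).im * Real.log (((i : ℕ) + 2 : ℕ) : ℝ))) =
        ∑ i : Fin n, y i * Real.sin ((ρ₀ : ℂ).im * Real.log (((i : ℕ) + 2 : ℕ) : ℝ)) := rfl
    rw [e]
    nlinarith [sq_nonneg (∑ i : Fin n, y i * (Real.cos ((ρ₀ : ℂ).im * Real.log (((i : ℕ) + 2 : ℕ) : ℝ)) - 1)),
      hα.le]

/-- **EM-1's CHRISTOFFEL LAW, EXPLAINED: RH ⟹ `K_M(γ₀,γ₀) = cᵀS_M⁻¹c + sᵀS_M⁻¹s ≤ γ₀²/m(ρ₀)`, i.e.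
`λ_M(γ₀) = γ₀²/K_M(γ₀,γ₀) ≥ m(ρ₀)`, for every `M ≥ 2` with `S_M ≻ 0` and every non-trivial zero `ρ₀ = ½ + iγ₀`** — the
certified table «`λ_M(γ_k) > 1`, `k ≤ 22`, `M ≤ 512`» (HOME/DATA.md §EM-1/§EM-2) is this RH-consequence read at simple zeros
(`S_M ≻ 0`: an RH-consequence, `IntegerScrewPivotCriterion.screwMatrix_posDef_of_riemannHypothesis`, and a kernel theorem
for `M ≤ 128`, `IntegerScrewRung128.screwMatrix_posDef_of_le_127`). RH-CONSEQUENCE; the binder is never dropped; nothing here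
bears on the truth of RH. [cite: Suzuki2023, (1.9) and Thm 1.2] -/
theorem christoffel_le_of_riemannHypothesis (hRH : _root_.RiemannHypothesis) (hS : (screwMatrix n).PosDef)
    (ρ₀ : riemannZetaNontrivialZeros) :
    (fun i : Fin n => Real.cos ((ρ₀ : ℂ).im * Real.log (((i : ℕ) + 2 : ℕ) : ℝ)) - 1) ⬝ᵥ
          ((screwMatrix n)⁻¹ *ᵥ fun i : Fin n => Real.cos ((ρ₀ : ℂ).im * Real.log (((i : ℕ) + 2 : ℕ) : ℝ)) - 1) +
        (fun i : Fin n => Real.sin ((ρ₀ : ℂ).im * Real.log (((i : ℕ) + 2 : ℕ) : ℝ))) ⬝ᵥ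
          ((screwMatrix n)⁻¹ *ᵥ fun i : Fin n => Real.sin ((ρ₀ : ℂ).im * Real.log (((i : ℕ) + 2 : ℕ) : ℝ))) ≤
      (ρ₀ : ℂ).im ^ 2 / (riemannZetaZeroOrder (ρ₀ : ℂ) : ℝ) := by
  have h1 := cos_dotProduct_inv_le_of_riemannHypothesis n hRH hS ρ₀
  have h2 := sin_dotProduct_inv_le_of_riemannHypothesis n hRH hS ρ₀
  have hm : (0 : ℝ) < riemannZetaZeroOrder (ρ₀ : ℂ) := by
    have : (1 : ℝ) ≤ riemannZetaZeroOrder (ρ₀ : ℂ) := by exact_mod_cast riemannZetaNontrivialZeros.one_le_order ρ₀.2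
    linarith
  have e : (ρ₀ : ℂ).im ^ 2 / (2 * (riemannZetaZeroOrder (ρ₀ : ℂ) : ℝ)) + (ρ₀ : ℂ).im ^ 2 / (2 * (riemannZetaZeroOrder (ρ₀ : ℂ) : ℝ))
      = (ρ₀ : ℂ).im ^ 2 / (riemannZetaZeroOrder (ρ₀ : ℂ) : ℝ) := by
    field_simp; ring
  linarith

/-- **`λ_M(γ₀) ≥ 1` under RH** (`m(ρ₀) ≥ 1`): `K_M(γ₀,γ₀) ≤ γ₀²` — EM-1's Q-score inequality verbatim, for every `M`
with `S_M ≻ 0` and every zero. RH-CONSEQUENCE. [cite: Suzuki2023, (1.9) and Thm 1.2] -/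
theorem christoffel_le_sq_im_of_riemannHypothesis (hRH : _root_.RiemannHypothesis) (hS : (screwMatrix n).PosDef)
    (ρ₀ : riemannZetaNontrivialZeros) :
    (fun i : Fin n => Real.cos ((ρ₀ : ℂ).im * Real.log (((i : ℕ) + 2 : ℕ) : ℝ)) - 1) ⬝ᵥ
          ((screwMatrix n)⁻¹ *ᵥ fun i : Fin n => Real.cos ((ρ₀ : ℂ).im * Real.log (((i : ℕ) + 2 : ℕ) : ℝ)) - 1) +
        (fun i : Fin n => Real.sin ((ρ₀ : ℂ).im * Real.log (((i : ℕ) + 2 : ℕ) : ℝ))) ⬝ᵥ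
          ((screwMatrix n)⁻¹ *ᵥ fun i : Fin n => Real.sin ((ρ₀ : ℂ).im * Real.log (((i : ℕ) + 2 : ℕ) : ℝ))) ≤
      (ρ₀ : ℂ).im ^ 2 := by
  refine (christoffel_le_of_riemannHypothesis n hRH hS ρ₀).trans (div_le_self (sq_nonneg _) ?_)
  exact_mod_cast riemannZetaNontrivialZeros.one_le_order ρ₀.2

end Summit.RiemannHypothesis.RiemannHypothesis.Theorems.ScrewChristoffel

end
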